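import Literature.Analysis.FluidPDE.PeriodicLerayExistence
import Literature.Analysis.FluidPDE.PeriodicLerayProfileLq
import HarnessLib

/-!
# Tools for `H⁻¹` bounds of pairings `∫ ⟪F, ζ⟫` against test fields

Analysis/FluidPDE proof file (theorems only) for the discharge of the named fact
`Literature.Analysis.FluidPDE.bradshawTsai2017_lemma_2_5` (`PeriodicLerayExistence.lean`;
Bradshaw–Tsai, Ann. Henri Poincaré 18 (2017) = arXiv:1510.07504 [BT1], Lemma 2.5), whose last
conclusion "`‖LW‖_{L^∞(0,T;H⁻¹(ℝ³))} ≤ c(R₀,U₀)`" is rendered in the tree as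
`|lerayPairing W s ζ| ≤ c · h1Norm ζ` for test fields `ζ`, with
`h1Norm ζ = (∫‖ζ‖² + ∫|Dζ|²)^{1/2}`. The printed proof obtains it from `L²` bounds on `∂ₛw`, `w`,
`y·∇w`, `∇w` and `L¹ ∩ L^∞` bounds on the commutator `L(ξU₀)`; the passage from such bounds to
the dual estimate is Cauchy–Schwarz, recorded here once and for all:

* `abs_integral_inner_le_of_eLpNorm_le`: `|∫⟪F, ζ⟫| ≤ B (∫‖ζ‖²)^{1/2}` whenever `‖F‖_{L²} ≤ B`
  and `ζ` is continuous with compact support (Hölder in `ℝ≥0∞`, no integrability bookkeeping);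
* `sqrt_integral_norm_sq_le_h1Norm`, `sqrt_integral_norm_fderiv_apply_sq_le_h1Norm`:
  `(∫‖ζ‖²)^{1/2} ≤ ‖ζ‖_{H¹}` and `(∫‖Dζ eᵢ‖²)^{1/2} ≤ ‖ζ‖_{H¹}` for the frame `(eᵢ)` of
  `frobeniusInner`/`frobeniusNormSq`;
* `eLpNorm_two_le_of_norm_le_mul`: `‖F‖_{L²} ≤ K (∫ ρ²)^{1/2}`-type bounds from pointwise
  domination `‖F‖ ≤ K ρ` by a fixed square-integrable weight (used with `ρ = (1+|y|)⁻²`).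

## References

* Z. Bradshaw, T.-P. Tsai, Ann. Henri Poincaré 18 (2017) = arXiv:1510.07504, proof of Lemma 2.5
  [BradshawTsai2017AHP].
-/

noncomputable section

open MeasureTheory Set Function Filter Topology TopologicalSpace Metric InnerProductSpace
open scoped NNReal ENNReal RealInnerProductSpace

namespace Literature.Analysis.FluidPDE

namespace BradshawTsai2017

variable {F' : Type*} [NormedAddCommGroup F'] [InnerProductSpace ℝ F']

/-! ### `L²` norms of continuous compactly supported fields -/

omit [InnerProductSpace ℝ F'] in
/-- `‖ζ‖_{L²} = ofReal ((∫‖ζ‖²)^{1/2})` for `ζ ∈ L²`. [folklore] -/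
theorem eLpNorm_two_eq_ofReal_sqrt_integral_norm_sq [NormedSpace ℝ F']
    {ζ : EuclideanSpace ℝ (Fin 3) → F'} (hζ : MemLp ζ 2 volume) :
    eLpNorm ζ 2 volume = ENNReal.ofReal (Real.sqrt (∫ y, ‖ζ y‖ ^ 2)) := by
  have h := eLpNorm_natCast_eq_ofReal (n := 2) two_ne_zero (by exact_mod_cast hζ)
  rw [Nat.cast_ofNat] at h
  rw [h, Real.sqrt_eq_rpow]
  simp only [Nat.cast_ofNat, one_div]

/-- **Cauchy–Schwarz for pairings against test fields**: if `‖F‖_{L²} ≤ B` (`B ≥ 0`) and `ζ`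
is continuous with compact support, then `|∫ ⟪F, ζ⟫| ≤ B (∫ ‖ζ‖²)^{1/2}` (the integral on the
left is the Bochner integral; the estimate holds whether or not the integrand is integrable,
being derived from `‖∫ f‖ₑ ≤ ∫ ‖f‖ₑ` and Hölder's inequality in `ℝ≥0∞`). [folklore] -/
theorem abs_integral_inner_le_of_eLpNorm_le {F ζ : EuclideanSpace ℝ (Fin 3) → F'}
    (hF : AEStronglyMeasurable F volume) {B : ℝ} (hB : 0 ≤ B)
    (hFB : eLpNorm F 2 volume ≤ ENNReal.ofReal B) (hζ : Continuous ζ)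
    (hζc : HasCompactSupport ζ) :
    |∫ y, ⟪F y, ζ y⟫| ≤ B * Real.sqrt (∫ y, ‖ζ y‖ ^ 2) := by
  have hζ2 : MemLp ζ 2 volume := hζ.memLp_of_hasCompactSupport hζc
  set S : ℝ := Real.sqrt (∫ y, ‖ζ y‖ ^ 2) with hS
  have hS0 : 0 ≤ S := Real.sqrt_nonneg _
  have hζn : eLpNorm ζ 2 volume = ENNReal.ofReal S := eLpNorm_two_eq_ofReal_sqrt_integral_norm_sq hζ2
  -- Hölder in `ℝ≥0∞`
  have h1 : ‖∫ y, ⟪F y, ζ y⟫‖ₑ ≤ ENNReal.ofReal B * ENNReal.ofReal S := by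
    refine (enorm_integral_le_lintegral_enorm _).trans ?_
    have h2 : ∫⁻ y, ‖⟪F y, ζ y⟫‖ₑ ≤ ∫⁻ y, ‖F y‖ₑ * ‖ζ y‖ₑ := by
      refine lintegral_mono fun y => ?_
      rw [← ofReal_norm, ← ofReal_norm, ← ofReal_norm, ← ENNReal.ofReal_mul (norm_nonneg _)]
      exact ENNReal.ofReal_le_ofReal (norm_inner_le_norm _ _)
    refine h2.trans ?_
    have h3 := ENNReal.lintegral_mul_le_Lp_mul_Lq volume Real.HolderConjugate.two_two hF.enorm
      hζ.aestronglyMeasurable.enorm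
    refine h3.trans ?_
    have eF : (∫⁻ y, ‖F y‖ₑ ^ (2 : ℝ)) ^ (1 / (2 : ℝ)) = eLpNorm F 2 volume := by
      rw [eLpNorm_eq_lintegral_rpow_enorm_toReal two_ne_zero ENNReal.ofNat_ne_top,
        ENNReal.toReal_ofNat]
    have eζ : (∫⁻ y, ‖ζ y‖ₑ ^ (2 : ℝ)) ^ (1 / (2 : ℝ)) = eLpNorm ζ 2 volume := by
      rw [eLpNorm_eq_lintegral_rpow_enorm_toReal two_ne_zero ENNReal.ofNat_ne_top,
        ENNReal.toReal_ofNat]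
    rw [eF, eζ, hζn]
    exact mul_le_mul' hFB le_rfl
  rw [← ofReal_norm, ← ENNReal.ofReal_mul hB] at h1
  rw [← Real.norm_eq_abs]
  exact (ENNReal.ofReal_le_ofReal_iff (by positivity)).1 h1

/-! ### The `H¹` norm dominates the `L²` norms of `ζ` and of `Dζ eᵢ` -/

/-- `(∫‖ζ‖²)^{1/2} ≤ ‖ζ‖_{H¹}`. [folklore] -/
theorem sqrt_integral_norm_sq_le_h1Norm (ζ : EuclideanSpace ℝ (Fin 3) → EuclideanSpace ℝ (Fin 3)) :
    Real.sqrt (∫ y, ‖ζ y‖ ^ 2) ≤ h1Norm ζ := by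
  rw [h1Norm]
  exact Real.sqrt_le_sqrt (le_add_of_nonneg_right (integral_nonneg fun y =>
    frobeniusNormSq_nonneg _))

/-- `(∫‖Dζ eᵢ‖²)^{1/2} ≤ ‖ζ‖_{H¹}` for the standard frame (`‖L eᵢ‖² ≤ |L|²` pointwise), for a
test field `ζ`. [folklore] -/
theorem sqrt_integral_norm_fderiv_apply_sq_le_h1Norm
    {ζ : EuclideanSpace ℝ (Fin 3) → EuclideanSpace ℝ (Fin 3)} (hζ : ContDiff ℝ 1 ζ)
    (hζc : HasCompactSupport ζ) (i : Fin (Module.finrank ℝ (EuclideanSpace ℝ (Fin 3)))) :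
    Real.sqrt (∫ y, ‖fderiv ℝ ζ y (stdOrthonormalBasis ℝ (EuclideanSpace ℝ (Fin 3)) i)‖ ^ 2) ≤
      h1Norm ζ := by
  rw [h1Norm]
  refine Real.sqrt_le_sqrt ?_
  have hcont : Continuous (fderiv ℝ ζ) := hζ.continuous_fderiv one_ne_zero
  have hD0 : ∀ y, y ∉ tsupport ζ → fderiv ℝ ζ y = 0 := fun y hy =>
    image_eq_zero_of_notMem_tsupport fun h => hy (tsupport_fderiv_subset ℝ h)
  have hs1 : HasCompactSupport fun y => frobeniusNormSq (fderiv ℝ ζ y) :=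
    HasCompactSupport.intro hζc fun y hy => by rw [hD0 y hy, frobeniusNormSq_zero]
  have hs2 : HasCompactSupport fun y =>
      ‖fderiv ℝ ζ y (stdOrthonormalBasis ℝ (EuclideanSpace ℝ (Fin 3)) i)‖ ^ 2 :=
    HasCompactSupport.intro hζc fun y hy => by
      rw [hD0 y hy, _root_.zero_apply, norm_zero, zero_pow two_ne_zero]
  have hc1 : Continuous fun y => frobeniusNormSq (fderiv ℝ ζ y) := by
    unfold frobeniusNormSq
    exact continuous_finsetSum _ fun j _ => (hcont.clm_apply continuous_const).norm.pow 2
  have hc2 : Continuous fun y =>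
      ‖fderiv ℝ ζ y (stdOrthonormalBasis ℝ (EuclideanSpace ℝ (Fin 3)) i)‖ ^ 2 :=
    (hcont.clm_apply continuous_const).norm.pow 2
  have hi : Integrable (fun y => frobeniusNormSq (fderiv ℝ ζ y)) volume :=
    hc1.integrable_of_hasCompactSupport hs1
  have hi' : Integrable (fun y => ‖fderiv ℝ ζ y
      (stdOrthonormalBasis ℝ (EuclideanSpace ℝ (Fin 3)) i)‖ ^ 2) volume :=
    hc2.integrable_of_hasCompactSupport hs2
  have hpt : ∀ y, ‖fderiv ℝ ζ y (stdOrthonormalBasis ℝ (EuclideanSpace ℝ (Fin 3)) i)‖ ^ 2 ≤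
      frobeniusNormSq (fderiv ℝ ζ y) := fun y =>
    norm_apply_sq_le_frobeniusNormSq (stdOrthonormalBasis ℝ (EuclideanSpace ℝ (Fin 3)))
      (fderiv ℝ ζ y) i
  calc ∫ y, ‖fderiv ℝ ζ y (stdOrthonormalBasis ℝ (EuclideanSpace ℝ (Fin 3)) i)‖ ^ 2
      ≤ ∫ y, frobeniusNormSq (fderiv ℝ ζ y) :=
        integral_mono hi' hi hpt
    _ ≤ (∫ y, ‖ζ y‖ ^ 2) + ∫ y, frobeniusNormSq (fderiv ℝ ζ y) :=
        le_add_of_nonneg_left (integral_nonneg fun y => by positivity)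

/-! ### `L²` bounds from domination by a square-integrable weight -/

omit [InnerProductSpace ℝ F'] in
/-- If `‖F(y)‖ ≤ K ρ(y)` pointwise with `K ≥ 0`, `ρ ≥ 0`, then `‖F‖_{L²} ≤ K ‖ρ‖_{L²}`. [folklore] -/
theorem eLpNorm_le_of_norm_le_mul {X : Type*} [MeasurableSpace X] {μ : Measure X}
    {F : X → F'} {ρ : X → ℝ} {K : ℝ} (hK : 0 ≤ K) (h : ∀ y, ‖F y‖ ≤ K * ρ y) (p : ℝ≥0∞) :
    eLpNorm F p μ ≤ ENNReal.ofReal K * eLpNorm ρ p μ := by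
  have h1 : eLpNorm F p μ ≤ eLpNorm (fun y => K * ρ y) p μ :=
    eLpNorm_mono fun y => (h y).trans (by rw [Real.norm_eq_abs]; exact le_abs_self _)
  refine h1.trans (le_of_eq ?_)
  have e : (fun y => K * ρ y) = K • ρ := rfl
  rw [e, eLpNorm_const_smul, Real.enorm_eq_ofReal hK]

/-- **The Japanese bracket `(1+|y|)⁻²` is square integrable on `ℝ³`** (`∫(1+|y|)⁻⁴ < ∞`,
`4 > 3`, Mathlib's `finite_integral_one_add_norm`): `‖(1+|·|)⁻²‖_{L²} < ∞`. [folklore] -/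
theorem eLpNorm_bracket_lt_top :
    eLpNorm (fun y : EuclideanSpace ℝ (Fin 3) => ((1 + ‖y‖) ^ 2)⁻¹) 2 volume < ⊤ := by
  have hmeas : AEStronglyMeasurable (fun y : EuclideanSpace ℝ (Fin 3) => ((1 + ‖y‖) ^ 2)⁻¹)
      volume := by
    refine Continuous.aestronglyMeasurable ?_
    exact ((continuous_const.add continuous_norm).pow 2).inv₀ fun y =>
      pow_ne_zero 2 (add_pos_of_pos_of_nonneg one_pos (norm_nonneg y)).ne'
  rw [eLpNorm_eq_lintegral_rpow_enorm_toReal two_ne_zero ENNReal.ofNat_ne_top,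
    ENNReal.toReal_ofNat]
  refine ENNReal.rpow_lt_top_of_nonneg (by norm_num) (ne_of_lt ?_)
  have e : ∀ y : EuclideanSpace ℝ (Fin 3), ‖((1 + ‖y‖) ^ 2)⁻¹‖ₑ ^ (2 : ℝ) =
      ENNReal.ofReal ((1 + ‖y‖) ^ (-(4 : ℝ))) := by
    intro y
    have hy : 0 < 1 + ‖y‖ := by positivity
    rw [← ofReal_norm, Real.norm_of_nonneg (by positivity),
      ENNReal.ofReal_rpow_of_nonneg (by positivity) (by norm_num)]
    congr 1
    rw [← Real.rpow_natCast, ← Real.rpow_neg hy.le, ← Real.rpow_mul hy.le]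
    norm_num
  simp_rw [e]
  exact finite_integral_one_add_norm (by rw [finrank_euclideanSpace_fin]; norm_num)

end BradshawTsai2017

end Literature.Analysis.FluidPDE

end
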